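/-
Copyright: lit-balaban cell, Phase-2 proof seat p11 (gen 6).  Statement-level skeleton of a published paper; no proof claims beyond
what the kernel checks below.
-/
import Literature.MathematicalPhysics.QuantumFieldTheory.BalabanImbrieJaffe1984to88.BIJ85Claim73SecondForm
import Literature.MathematicalPhysics.QuantumFieldTheory.BalabanImbrieJaffe1984to88.BIJ85Eq625Torus

/-!
# `BalabanImbrieJaffe1984to88.BIJ85LineSumExact` — T. Bałaban, J. Imbrie, A. Jaffe, *Renormalization of the Higgs model: minimizers,
propagators and the stability of mean field theory*, Commun. Math. Phys. **97** (1985) 299–329 [BalabanImbrieJaffe1985]: Sect. 7.3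
p. 326, the closing paragraph — **THE LINE-SUM DEFECT OF THE SECOND PRINTED FORM OF (7.3.2) ON EXACT FIELDS, AS AN IDENTITY OF THE
MINIMIZERS**.  The paper's mechanism for the regularity of the actual background `u_k` of (4.5.4), verbatim: *"we can substitute
𝒟_k∂^* = G_{k,Ax}∂^* + ∂D in the formula for u_k, we use (5.3.1) to replace this by a minimizer in axial gauge. Then we use (5.1.1) to return
the minimizers to Landau gauge. This is a local procedure since f^{(k)} can locally be represented as a curl."*  Exactly these three steps,
kernel-checked on the tori for the operators OF RECORD (`T_k = 𝒟_k∂^*Q^{e*}_k` = p31's `TkF`, `H_k = HkE`, Prop. 5.2.2's `D` = gen 1's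
`D527E`, Prop. 5.1.1's `λ_k` = p30's `lamE`), give on EXACT unit-lattice plaquette fields `g = ∂B`:
**`T_k∂B = Q^{s*}_kB − H_kB − ∂Γ_B`, `Γ_B = λ_k(H_kB) + D(Q^{e*}_k∂B)`** (`DkE_dOne_eq`), hence for the line sums along a unit bond `b`
(file A's `lineSumIter`, the gauge-invariant defect `v_b^{−1}u_k(b) = exp(−ie_kη·Σ_{b′⊂b}(T_kf^{(k)})_{b′})` of file B's `lineIter_actualBgU1`):
**`η·Σ_{b′⊂b}(T_k∂B)_{b′} = B_b − η·Σ_{b′⊂b}(H_kB)_{b′} − [Γ_B(b₊) − Γ_B(b₋)]`** (`lineSum_TkF_exact`) — the located line-sum constant `K_T` of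
file B (`SecClosedIdx.hT`) is thereby REDUCED, on exact fields, to two Sect. 7.2 quantities: the straight-line averages of the Landau
minimizer `H_kB` along unit bonds against its datum `B_b` (rows C1.Eq7.2.1-7.2.2) and the sup of the gauge functions of Props. 5.1.1/5.2.2
((7.2.4) *"The gauge transformation λ in (5.1.1) is bounded"*, row C1.Eq7.2.4) — `lineSum_bound_of_pieces`.  File C of the gen-6 member
(second printed form) of SKELETON row **C1.Eq7.3.1-7.3.2** (seat p11 gen 6; files A `BIJ85Ineq732SecondForm`, B `BIJ85Claim73SecondForm`).

statement-level skeleton of published theorems with citation tags; proofs where landed; nothing here is a claim about the Yang–Mills mass gap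

PDF held: `paper:balaban1985-cmp97-bij-higgs-minimizers` (journal page = PDF page + 298).  Pages read this session (`lit read`, OCR text):
p. 313–317 [PDF 15–19] ((5.1.1)–(5.1.4), (5.2.6)–(5.2.10), (5.3.1)), p. 326 [PDF 28].

CITATION HEADER (lean-in-tree rule).  Phase-2 file of the lit-balaban TYPED SKELETON (HOME `run/shared/lean/pub/lit-balaban/`), seat
p11 gen 6 (unit `lit-balaban-p11-g6`; TAKING line HOME/STATUS.md 2026-08-21T20:03:16Z; owner r15, referee ref-5).  Objects BY NAME,
nothing re-declared: p30's `HaxE_eq_531` ((5.3.1) on the tori), `expField_ofLp_QsE`, `lamE`; gen 1's `prop522_torus_apply` (Prop. 5.2.2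
(5.2.6)–(5.2.7)), `HaxE_sub_HkE` (Prop. 5.1.1), `D527E`, `HkE`/`DkE`; p09's `QsE`/`dOne`/`QesOp`/`curlOp`/`gradV1`; p31's `TkF`; files A–B's
`lineSumU`/`lineSumIter`/`lineIter_phase`/`vK`/`lineIter_vK`/`fieldEquiv_expField`; r18's `corner`/`corner_shift`/`runSite`/`runBond`.
Definitions with bodies: `lvlR` (transport of a real bond function along `0 + k = k`), `gaugeFnExact` (= `Γ_B`, an abbreviation); otherwise theorems only (no `def … : Prop`, no named fact; D-0026).

THE PRINTED TEXT, verbatim.  p. 313 [PDF 15]: *"We claim that H_{k,Ax}B and H_kB differ by a gauge transformation, H_{k,Ax}B − H_kB = ∂λ.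
(5.1.1) We show that λ is an explicit, linear function of H_kB."*; p. 316 [PDF 18]: *"Proposition 5.2.2. There is a gauge transformation
D such that G_{k,Ax}∂^* − 𝒟_k∂^* = ∂D. (5.2.6) Explicitly D = Σ_{j=0}^{k−1} λ_j(H_jC^{(j)}H_j^*∂^*), (5.2.7)"* (v1.1 docfix, ref-1 F4-nit 2026-08-21T22:28Z:
v1 quoted (5.2.6) in the rearranged form `G_{k,Ax}∂^* = 𝒟_k∂^* + ∂D`, which is how print itself re-uses it on p. 326, *"we can substitute 𝒟_k∂^* =
G_{k,Ax}∂^* + ∂D"* — a sign slip in print's p. 326 sentence relative to (5.2.6); the Lean statements below follow (5.2.6) as printed on p. 316); p. 317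
[PDF 19]: *"H_{k,Ax}B = Q^{s*}_kB − G_{k,Ax}∂^*Q^{e*}_k∂B. (5.3.1)"*; p. 326 [PDF 28] as quoted above.

WHAT IS PROVED HERE (0 `sorry`, standard axioms).
* §1 line sums of gradients telescope: `lineSumU_grad`, **`lineSumIter_grad`** (`Σ_{b′⊂b}(∂_cλ)(b′) = c·[λ(b₊) − λ(b₋)]`, corners read through
  `cornerIter k`); line sums of the pull-back: **`eta_mul_lineSumIter_QsE`** (`η·Σ_{b′⊂b}(Q^{s*}_kB)(b′) = B_b` — through the `U(1)`
  dictionary (4.5.2) `expField_ofLp_QsE` and file B's `lineIter_vK`: `exp(ieη·Σ(Q^{s*}_kB)) = exp(ieB_b)` for EVERY `e`, whence equality).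
* §2 **`DkE_dOne_eq`**: `𝒟_k∂^*Q^{e*}_k∂B = Q^{s*}_kB − H_kB − ∂(λ_k(H_kB) + D(Q^{e*}_k∂B))` on the Euclidean carriers (from (5.3.1), (5.2.6), (5.1.1));
  `TkF_dOne_apply` (p31's `T_k` on functions at `g = ∂B`, unit-lattice curl `dOne`, is this vector read componentwise).
* §3 **`lineSum_TkF_exact`**: `η·Σ_{b′⊂b}(T_k∂B)_{b′} = B_b − η·Σ_{b′⊂b}(H_kB)_{b′} − [Γ_B(b₊) − Γ_B(b₋)]`; **`lineSum_bound_of_pieces`**: if for an exact `g`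
  SOME potential `B` (`∂B = g`) has `|B_b − η·Σ_{b′⊂b}(H_kB)_{b′}| ≤ K_H·C` and `|Γ_B| ≤ K_Γ·C` then `η·|Σ_{b′⊂b}(T_kg)_{b′}| ≤ (K_H + 2K_Γ)·C` — the
  shape of file B's index field `hT` on exact fields (the potential may be chosen per field and per bond: *"a local procedure"*).
HONEST SCOPE.  Identities and the triangle inequality only; the two Sect. 7.2 sup-norm inputs (straight-line averages of `H_k`, boundedness of
the gauge functions `λ_k`, `D` — rows C1.Eq7.2.1-7.2.2 / C1.Eq7.2.4) are NOT proved here; closed non-exact (harmonic) sources on the torus are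
not treated (as in GAPS G-C1-05 ADDENDUM 4a).  Base level `0`, standing range `k ≤ m + K`, weights `w = η^d`, `c = η⁻¹` where the actual
background is concerned (the identity of §2 holds for every `w > 0`, `c ≠ 0`).
-/

open scoped RealInnerProductSpace BigOperators
open Finset Complex

namespace Literature.MathematicalPhysics.QuantumFieldTheory.BalabanImbrieJaffe1984to88.BIJ85LineSumExact

open Literature.MathematicalPhysics.QuantumFieldTheory.Balaban1983to89
open LatticeFieldCalculus (grad grad_apply)
open BIJ88Sect3Statements (U1 toC toC_one toC_mul norm_toC)
open BIJ88Sect3Rescaling (toC_injective_U1 fieldEquiv fieldEquiv_apply circleEquivU1)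
open BIJ85Sect1Model (U1Field plaq)
open BIJ85SmallFieldSplit64 (plaqField expField)
open BIJ85BlockAveragesTorus BIJ85BlockAveragesTorusK
open BIJ85Ineq732SecondForm BIJ85Claim73SecondForm
open BIJ85Ineq732Background (phase)
open BIJ85AxialPropagator411 (BondSpace PlaqSpace curlOp toE)
open BIJ85Prop521Torus (CoarseSpace toEj QsE QsE_apply)
open BIJ85Prop522Torus (CE DkE HkE HaxE GaxE D527E HaxE_sub_HkE prop522_torus_apply)
open BIJ85LandauMinimizer442V1 (gradV1 gradV1_apply)
open BIJ85Prop511Torus (lamE)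
open BIJ85Sigma421Torus (toU QesOp UnitPlaqSpace)
open BIJ85Sigma422Eta (eta_pos eta_inv)
open BIJ85Eq611Torus (dOne dOne_apply)
open BIJ85Eq625Torus (HaxE_eq_531)
open BIJ85Eq622Torus (qsU1Iter expField_ofLp_QsE)
open BIJ85Eq454PlaqResidual (eta_mul_L_pow)
open BIJ88Eq541Base0 (TkF TkF_apply)

noncomputable section

variable {P : Params}

/-! ## §1 Line sums of gradients telescope; line sums of the pull-back `Q^{s*}_kB` -/

/-- kernel: the telescoping sum along a straight run, `Σ_{t<n} [λ(x + (t+1)e_μ) − λ(x + te_μ)] = λ(x + ne_μ) − λ(x)`. [folklore] -/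
private theorem sum_range_runSite_sub {j : ℕ} (lam : Balaban1983to89.Site P j → ℝ) (x : Balaban1983to89.Site P j) (μ : Fin P.d) :
    ∀ n : ℕ, ∑ t ∈ range n, (lam (runSite x μ (t + 1)) - lam (runSite x μ t)) = lam (runSite x μ n) - lam x
  | 0 => by simp
  | n + 1 => by rw [sum_range_succ, sum_range_runSite_sub lam x μ n]; ring

/-- **the line sum of a gradient along `Γ_{yy′}` telescopes**: `lineSumU (∂_cλ) = ∂_c(λ ∘ corner)` — `Σ_{t<L} c[λ(x_{t+1}) − λ(x_t)] =
c[λ(corner y′) − λ(corner y)]` (r18's `corner_shift`: the run of `L` bonds from the corner of `y` ends at the corner of `y + e_μ`; standing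
range). [cite: BalabanImbrieJaffe1985, (5.1.2) p.313] -/
theorem lineSumU_grad {j : ℕ} (hj : j + 1 ≤ P.m + P.K) (c : ℝ) (lam : Balaban1983to89.Site P j → ℝ) :
    lineSumU (grad c lam) = grad c (fun y : Balaban1983to89.Site P (j + 1) => lam (corner y)) := by
  funext b
  rw [lineSumU, grad_apply]
  have e1 : ∀ t, grad c lam (runBond (corner b.src) b.dir t)
      = c * (lam (runSite (corner b.src) b.dir (t + 1)) - lam (runSite (corner b.src) b.dir t)) := by
    intro t
    rw [show runBond (corner b.src) b.dir t = ⟨runSite (corner b.src) b.dir t, b.dir⟩ from rfl, grad_apply]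
    show c * (lam (PBond.tgt ⟨runSite (corner b.src) b.dir t, b.dir⟩) - lam (runSite (corner b.src) b.dir t)) = _
    rw [show PBond.tgt ⟨runSite (corner b.src) b.dir t, b.dir⟩ = (runSite (corner b.src) b.dir t).shift b.dir from rfl, runSite_shift]
  simp_rw [e1]
  rw [← mul_sum, sum_range_runSite_sub, ← corner_shift hj]
  rfl

/-- **the iterated line sum of a gradient telescopes**: `Σ_{b′⊂b}(∂_cλ)(b′) = c·[λ(cornerIter k b₊) − λ(cornerIter k b₋)]`, i.e.
`lineSumIter (∂_cλ) k = ∂_c(λ ∘ cornerIter k)` (standing range). [cite: BalabanImbrieJaffe1985, (5.1.2) p.313] -/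
theorem lineSumIter_grad {j : ℕ} (c : ℝ) (lam : Balaban1983to89.Site P j → ℝ) :
    ∀ (k : ℕ), j + k ≤ P.m + P.K → lineSumIter (grad c lam) k = grad c (fun y : Balaban1983to89.Site P (j + k) => lam (cornerIter k y))
  | 0, _ => rfl
  | k + 1, hk => by
    rw [lineSumIter_succ, lineSumIter_grad c lam k (by omega), lineSumU_grad (by omega)]
    rfl

/-- kernel: `exp(ita) = 1` for every real `t` forces `a = 0` (take `t = π/a`). [folklore] -/
private theorem eq_zero_of_forall_exp_eq_one {a : ℝ} (h : ∀ t : ℝ, Complex.exp (↑(t * a) * I) = 1) : a = 0 := by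
  by_contra ha
  have h1 := h (Real.pi / a)
  rw [div_mul_cancel₀ _ ha, Complex.exp_pi_mul_I] at h1
  norm_num at h1

/-- transport of a REAL bond function along an equality of levels (file B's `lvl` for real values, with the function type spelled
out: the unit-lattice datum `B` on `T^{(k)}` is read at the level `0 + k` of the line sums as `lvlR (Nat.zero_add k).symm B`).
[cite: BalabanImbrieJaffe1985, (2.1) p.302] -/
def lvlR {n n' : ℕ} (h : n = n') (θ : PBond P n → ℝ) : PBond P n' → ℝ := h ▸ θ

/-- kernel: transport commutes with scalar multiples. [cite: BalabanImbrieJaffe1985, (2.1) p.302] -/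
theorem lvlR_mul {n n' : ℕ} (h : n = n') (a : ℝ) (θ : PBond P n → ℝ) :
    lvlR h (fun b => a * θ b) = fun b => a * lvlR h θ b := by
  subst h; rfl

/-- kernel: transport commutes with the phase map. [cite: BalabanImbrieJaffe1985, (4.5.1) p.312] -/
theorem lvl_phase {n n' : ℕ} (h : n = n') (θ : PBond P n → ℝ) : lvl h (phase θ) = phase (lvlR h θ) := by
  subst h; rfl

/-- kernel: file B's `vK` of an exponential field is the phase of the transported exponent: `vK k (exp(ieB)) = e^{i·e·B}` at level `0 + k`.
[cite: BalabanImbrieJaffe1985, (4.5.1) p.312] -/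
theorem vK_expField (k : ℕ) (e : ℝ) (B : PBond P k → ℝ) :
    vK k (expField e B) = phase (fun b => e * lvlR (Nat.zero_add k).symm B b) := by
  rw [vK, fieldEquiv_expField, lvl_phase, lvlR_mul]

/-- **`η·Σ_{b′⊂b}(Q^{s*}_kB)(b′) = B_b`**: the line sum of the Lie-algebra pull-back (2.17)/(4.5.2) along the unit bond `b` reproduces the datum
(one corridor bond carrying `η⁻¹B_b`, `L^k − 1` interior bonds carrying `0`) — obtained through the `U(1)` dictionary *"(Q^{s*}_kv)_b =
exp((ie_kηQ^{s*}_kB)_b) (4.5.2)"* (p30's `expField_ofLp_QsE`) and file B's `lineIter_vK` ((4.5.3): the `Q^{s*}_kv`-transport along `b` is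
`v_b`): `exp(ieη·Σ(Q^{s*}_kB)) = exp(ieB_b)` for every `e`, whence equality (standing range). [cite: BalabanImbrieJaffe1985, (4.5.2) p.312] -/
theorem eta_mul_lineSumIter_QsE {k : ℕ} (hk : k ≤ P.m + P.K) (B : CoarseSpace P k) (b : PBond P (0 + k)) :
    P.eta k * lineSumIter (fun b' : PBond P 0 => QsE P k B b') k b = lvlR (Nat.zero_add k).symm (WithLp.ofLp B) b := by
  have hη := eta_mul_L_pow P k
  -- for every e: the transports of exp(ieη Q^{s*}_kB) along b, two ways
  have key : ∀ e : ℝ, phase (lineSumIter (fun b' : PBond P 0 => (e * P.eta k) * QsE P k B b') k) b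
      = phase (fun b'' => e * lvlR (Nat.zero_add k).symm (WithLp.ofLp B) b'') b := by
    intro e
    have h1 := lineIter_vK hk (expField e (WithLp.ofLp B))
    rw [← expField_ofLp_QsE hk e (P.eta k) hη B, fieldEquiv_expField, lineIter_phase, vK_expField] at h1
    exact congr_fun h1 b
  have key' : ∀ e : ℝ, Complex.exp (↑(e * (P.eta k * lineSumIter (fun b' : PBond P 0 => QsE P k B b') k b
      - lvlR (Nat.zero_add k).symm (WithLp.ofLp B) b)) * I) = 1 := by
    intro e
    have h := congr_arg toC (key e)
    rw [lineSumIter_smul] at h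
    change toC (BIJ85BlockAveragesTorus.expU1 _) = toC (BIJ85BlockAveragesTorus.expU1 _) at h
    rw [toC_expU1, toC_expU1] at h
    have hne : Complex.exp (↑(e * lvlR (Nat.zero_add k).symm (WithLp.ofLp B) b) * I) ≠ 0 := Complex.exp_ne_zero _
    rw [← div_eq_one_iff_eq hne, ← Complex.exp_sub] at h
    rw [← h]
    congr 1
    push_cast
    ring
  have h0 := eq_zero_of_forall_exp_eq_one key'
  linarith

/-! ## §2 `T_k∂B = Q^{s*}_kB − H_kB − ∂Γ_B` from (5.3.1), (5.2.6), (5.1.1) -/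

/-- **`𝒟_k∂^*Q^{e*}_k∂B = Q^{s*}_kB − H_kB − ∂[λ_k(H_kB) + D(Q^{e*}_k∂B)]`** on the Euclidean carriers of the tori, for every unit-lattice bond
field `B`, every `w > 0`, `c ≠ 0` (`k ≤ m + K`, `2 ≤ d`) — the three printed steps of p. 326: (5.2.6) `G_{k,Ax}∂^* = 𝒟_k∂^* + ∂D` (gen 1's
`prop522_torus_apply`), (5.3.1) `H_{k,Ax}B = Q^{s*}_kB − G_{k,Ax}∂^*Q^{e*}_k∂B` (p30's `HaxE_eq_531`), (5.1.1) `H_{k,Ax}B − H_kB = ∂λ_k(H_kB)` (gen 1's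
`HaxE_sub_HkE`). [cite: BalabanImbrieJaffe1985, (5.3.1) p.317] -/
theorem DkE_dOne_eq (hd : 2 ≤ P.d) {k : ℕ} (hk : k ≤ P.m + P.K) {c : ℝ} (hc : c ≠ 0) {w : ℝ} (hw : 0 < w) (B : CoarseSpace P k) :
    DkE P w c k (LinearMap.adjoint (curlOp (P := P) w c) (QesOp (P := P) hd w k (dOne P k c B))) =
      QsE P k B - HkE P w c k B
        - gradV1 P c (lamE P c k (HkE P w c k B) + D527E P w c k (QesOp (P := P) hd w k (dOne P k c B))) := by
  set J : PlaqSpace P := QesOp (P := P) hd w k (dOne P k c B) with hJ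
  have h531 : HaxE P w c k B = QsE P k B - GaxE P w c k (LinearMap.adjoint (curlOp (P := P) w c) J) := by
    have h := LinearMap.congr_fun (HaxE_eq_531 hd hk hc hw) B
    simpa only [LinearMap.sub_apply, LinearMap.coe_comp, Function.comp_apply] using h
  have h522 := prop522_torus_apply hk hc hw J
  have h511 := HaxE_sub_HkE hk hc hw B
  have e1 : GaxE P w c k (LinearMap.adjoint (curlOp (P := P) w c) J) = QsE P k B - HaxE P w c k B := by rw [h531]; abel
  have e2 : HaxE P w c k B = HkE P w c k B + gradV1 P c (lamE P c k (HkE P w c k B)) := by rw [← h511]; abel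
  rw [eq_sub_of_add_eq h522.symm, e1, e2, map_add]
  abel

/-- kernel: p31's `T_k` on functions at the exact field `g = ∂B` (`dOne`, unit-lattice curl with factor `η⁻¹/L^k = 1` at `c = η⁻¹`) IS the
left-hand side of `DkE_dOne_eq` read componentwise. [cite: BalabanImbrieJaffe1985, (4.5.4) p.313] -/
theorem TkF_dOne_apply (hd : 2 ≤ P.d) (w η : ℝ) (k : ℕ) (B : CoarseSpace P k) (b : PBond P 0) :
    TkF P hd w η k (fun p => dOne P k η⁻¹ B p) b =
      DkE P w η⁻¹ k (LinearMap.adjoint (curlOp (P := P) w η⁻¹) (QesOp (P := P) hd w k (dOne P k η⁻¹ B))) b := by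
  rw [TkF_apply]
  rfl

/-! ## §3 The line-sum defect on exact fields and its reduction to two Sect. 7.2 quantities -/

/-- kernel: the line sum of a Euclidean gradient `gradV1 P c Γ` telescopes through the k-fold corners. [cite: BalabanImbrieJaffe1985, (5.1.2) p.313] -/
theorem lineSumIter_gradV1 {k : ℕ} (hk : k ≤ P.m + P.K) (c : ℝ) (Γ : EuclideanSpace ℝ (Balaban1983to89.Site P 0)) (b : PBond P (0 + k)) :
    lineSumIter (fun b' : PBond P 0 => gradV1 P c Γ b') k b = c * (Γ (cornerIter k b.tgt) - Γ (cornerIter k b.src)) := by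
  have h := lineSumIter_grad (j := 0) c (fun x => Γ x) k (by omega)
  have e : (fun b' : PBond P 0 => gradV1 P c Γ b') = grad c (fun x => Γ x) := by
    funext b'; rw [gradV1_apply]
  rw [e, h]
  rfl

/-- the gauge function `Γ_B = λ_k(H_kB) + D(Q^{e*}_k∂B)` of the exact-sector identity at the weights of record, as a term (abbreviation used in
the statements below; p30's `lamE`, gen 1's `D527E`). [cite: BalabanImbrieJaffe1985, (5.2.7) p.316] -/
abbrev gaugeFnExact (hd : 2 ≤ P.d) (k : ℕ) (B : CoarseSpace P k) : EuclideanSpace ℝ (Balaban1983to89.Site P 0) :=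
  lamE P (P.eta k)⁻¹ k (HkE P ((P.eta k) ^ P.d) (P.eta k)⁻¹ k B)
    + D527E P ((P.eta k) ^ P.d) (P.eta k)⁻¹ k (QesOp (P := P) hd ((P.eta k) ^ P.d) k (dOne P k (P.eta k)⁻¹ B))

/-- **THE LINE-SUM DEFECT ON EXACT FIELDS**: for every unit-lattice bond field `B` on `T^{(k)}` and every unit bond `b` (`k ≤ m + K`, `2 ≤ d`;
weights of record `w = η^d`, `c = η⁻¹`):
`η·Σ_{b′⊂b}(T_k∂B)_{b′} = B_b − η·Σ_{b′⊂b}(H_kB)_{b′} − [Γ_B(b₊) − Γ_B(b₋)]`, `Γ_B = λ_k(H_kB) + D(Q^{e*}_k∂B)` (corners of `b` read through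
`cornerIter k`; `B_b` through the transport `lvlR` along `0 + k = k`).  With file B's `lineIter_actualBgU1` (`v_b^{−1}u_k(b) = exp(−ie_kη·Σ(T_kf^{(k)}))`) this is the
p. 326 route *"substitute 𝒟_k∂^* = G_{k,Ax}∂^* + ∂D … use (5.3.1) … use (5.1.1) to return the minimizers to Landau gauge"* at the level of the
second printed form of (7.3.2). [cite: BalabanImbrieJaffe1985, (7.3.2) p.326] -/
theorem lineSum_TkF_exact (hd : 2 ≤ P.d) {k : ℕ} (hk : k ≤ P.m + P.K) (B : CoarseSpace P k) (b : PBond P (0 + k)) :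
    P.eta k * lineSumIter (TkF P hd ((P.eta k) ^ P.d) (P.eta k) k (fun p => dOne P k (P.eta k)⁻¹ B p)) k b =
      lvlR (Nat.zero_add k).symm (WithLp.ofLp B) b
        - P.eta k * lineSumIter (fun b' : PBond P 0 => HkE P ((P.eta k) ^ P.d) (P.eta k)⁻¹ k B b') k b
        - (gaugeFnExact hd k B (cornerIter k b.tgt) - gaugeFnExact hd k B (cornerIter k b.src)) := by
  set w : ℝ := (P.eta k) ^ P.d with hw
  have hwpos : 0 < w := pow_pos (eta_pos P k) _
  have hc : (P.eta k)⁻¹ ≠ 0 := inv_ne_zero (eta_pos P k).ne'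
  -- the bond function T_k∂B is Q^{s*}_kB − H_kB − ∂Γ, componentwise
  have hT : TkF P hd w (P.eta k) k (fun p => dOne P k (P.eta k)⁻¹ B p)
      = fun b' => (QsE P k B b' + -(HkE P w (P.eta k)⁻¹ k B b')) + -(gradV1 P (P.eta k)⁻¹ (gaugeFnExact hd k B) b') := by
    funext b'
    rw [TkF_dOne_apply, DkE_dOne_eq hd hk hc hwpos B, PiLp.sub_apply, PiLp.sub_apply]
    ring
  have e3 : lineSumIter (fun b' => (QsE P k B b' + -(HkE P w (P.eta k)⁻¹ k B b'))
        + -(gradV1 P (P.eta k)⁻¹ (gaugeFnExact hd k B) b')) k b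
      = lineSumIter (fun b' : PBond P 0 => QsE P k B b') k b - lineSumIter (fun b' : PBond P 0 => HkE P w (P.eta k)⁻¹ k B b') k b
        - lineSumIter (fun b' : PBond P 0 => gradV1 P (P.eta k)⁻¹ (gaugeFnExact hd k B) b') k b := by
    rw [lineSumIter_add, lineSumIter_add, lineSumIter_neg (fun b' => HkE P w (P.eta k)⁻¹ k B b'),
      lineSumIter_neg (fun b' => gradV1 P (P.eta k)⁻¹ (gaugeFnExact hd k B) b')]
    dsimp only
    ring
  rw [hT, e3, lineSumIter_gradV1 hk, mul_sub, mul_sub, eta_mul_lineSumIter_QsE hk B b, ← mul_assoc,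
    mul_inv_cancel₀ (eta_pos P k).ne', one_mul]

/-- **REDUCTION OF THE LINE-SUM CONSTANT ON EXACT FIELDS**: if an exact unit-lattice plaquette field `g` admits, for the unit bond `b`, a
potential `B` (`g = ∂B`, unit-lattice curl `dOne` at `c = η⁻¹`) with `|B_b − η·Σ_{b′⊂b}(H_kB)_{b′}| ≤ K_H·C` (straight-line averages of the Landau
minimizer, Sect. 7.2 (7.2.2)) and `|Γ_B| ≤ K_Γ·C` at the two corners of `b` (boundedness of the gauge functions of Props. 5.1.1/5.2.2, (7.2.4)),
then `η·|Σ_{b′⊂b}(T_kg)_{b′}| ≤ (K_H + 2K_Γ)·C` — the shape of file B's located field `SecClosedIdx.hT` (*"a local procedure"*: the potential may be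
chosen per field and per bond). [cite: BalabanImbrieJaffe1985, (7.2.4) p.326] -/
theorem lineSum_bound_of_pieces (hd : 2 ≤ P.d) {k : ℕ} (hk : k ≤ P.m + P.K) {g : Balaban1983to89.Plaq P k → ℝ} {B : CoarseSpace P k}
    (hg : g = fun p => dOne P k (P.eta k)⁻¹ B p) (b : PBond P (0 + k)) {KH KΓ C : ℝ}
    (hH : |lvlR (Nat.zero_add k).symm (WithLp.ofLp B) b
        - P.eta k * lineSumIter (fun b' : PBond P 0 => HkE P ((P.eta k) ^ P.d) (P.eta k)⁻¹ k B b') k b| ≤ KH * C)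
    (hΓt : |gaugeFnExact hd k B (cornerIter k b.tgt)| ≤ KΓ * C) (hΓs : |gaugeFnExact hd k B (cornerIter k b.src)| ≤ KΓ * C) :
    P.eta k * |lineSumIter (TkF P hd ((P.eta k) ^ P.d) (P.eta k) k g) k b| ≤ (KH + 2 * KΓ) * C := by
  subst hg
  rw [show P.eta k * |lineSumIter (TkF P hd ((P.eta k) ^ P.d) (P.eta k) k (fun p => dOne P k (P.eta k)⁻¹ B p)) k b|
      = |P.eta k * lineSumIter (TkF P hd ((P.eta k) ^ P.d) (P.eta k) k (fun p => dOne P k (P.eta k)⁻¹ B p)) k b| by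
    rw [abs_mul, abs_of_pos (eta_pos P k)], lineSum_TkF_exact hd hk B b]
  calc _ ≤ |lvlR (Nat.zero_add k).symm (WithLp.ofLp B) b
            - P.eta k * lineSumIter (fun b' : PBond P 0 => HkE P ((P.eta k) ^ P.d) (P.eta k)⁻¹ k B b') k b|
          + |gaugeFnExact hd k B (cornerIter k b.tgt) - gaugeFnExact hd k B (cornerIter k b.src)| := abs_sub _ _
    _ ≤ KH * C + (KΓ * C + KΓ * C) := add_le_add hH ((abs_sub _ _).trans (add_le_add hΓt hΓs))
    _ = (KH + 2 * KΓ) * C := by ring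

end

end Literature.MathematicalPhysics.QuantumFieldTheory.BalabanImbrieJaffe1984to88.BIJ85LineSumExact
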